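import Mathlib.Data.Matrix.Block
import Mathlib.RingTheory.MvPolynomial.Symmetric.FundamentalTheorem
import Mathlib.Combinatorics.Nullstellensatz
import Mathlib.Algebra.MvPolynomial.Monad
import Literature.NumberTheory.Automorphic.HarishChandraGLProofs
import HarnessLib

/-!
# Highest weight vectors for `𝔤𝔩ₙ^T` of all polynomial dominant weights, and Zariski density

Let `R` be a commutative ring, `T` a finite index type and `𝔤 = 𝔤𝔩ₙ(R)^T = (T → Matrix (Fin n)
(Fin n) R)`, a Lie algebra for the commutator bracket, with its upper triangular Borel subalgebra
(block-wise). A *highest weight vector* of weight `λ : T → Fin n → R` in a representation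
`ρ : 𝔤 →ₗ⁅R⁆ End V` is a nonzero `v` killed by the block strictly upper triangular matrices on
which the diagonal matrices `(diag h_τ)_τ` act by `∑_{τ,i} λ_{τ,i} h_{τ,i}`
(`IsHighestWeightVectorC`, the complex/split form of `Literature.NumberTheory.Automorphic.IsHighestWeightVector`).

This file supplies highest weight vectors of **every polynomial dominant weight** (`λ_{τ,·} :
Fin n → ℕ` antitone in each block), in modules living in `Type` (mirroring (H9) of
`HarishChandraGL`): compose the polynomial model `glPolyRep` of
`Literature/NumberTheory/Automorphic/HarishChandraGLProofs.lean` (`𝔤𝔩_ι(R)` acting on `R[x_pq]` by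
infinitesimal right translations, `ι = Fin n × T`) with the block-diagonal embedding
`𝔤𝔩ₙ(R)^T → 𝔤𝔩_{Fin n × T}(R)`; the products of powers of the block leading principal minors
(`hwPolyVec` with the nested block segments `blockSegC`) are highest weight vectors
(`glPolyDerivation_hwPolyVec`, `hwPolyVec_ne_zero` of that file), of weight
`Fin.accumulate n n (m τ)` in block `τ`.

It also records the **Zariski density** statement used to pin down the Harish-Chandra
homomorphism by its values on highest weights: a polynomial on `∏_τ Kⁿ` (`K` a domain of
characteristic zero) vanishing at all `λ + c` with `λ` polynomial dominant vanishes
(`eq_zero_of_forall_eval_antitone_eq_zero`, from Mathlib's combinatorial Nullstellensatz lemma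
`MvPolynomial.eq_zero_of_eval_zero_at_prod_finset`).

## Main definitions

* `Literature.Automorphic.IsHighestWeightVectorC ρ λ v` — highest weight vectors for `𝔤𝔩ₙ(R)^T`.
* `Literature.Automorphic.blockMinorRep T n R` — `𝔤𝔩ₙ(R)^T` acting on `R[x_pq : p q ∈ Fin n × T]`;
  `Literature.Automorphic.hwVec m` — the product of powers of block leading principal minors.

## Main statements

* `Literature.NumberTheory.Automorphic.isHighestWeightVectorC_hwVec` — `hwVec m` is a highest weight vector of
  weight `Fin.accumulate n n (m τ)` (over a nontrivial ring).
* `Literature.NumberTheory.Automorphic.exists_isHighestWeightVectorC_of_antitone` — every polynomial dominant weight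
  is the weight of a highest weight vector in some module `V : Type`.
* `Literature.NumberTheory.Automorphic.eq_zero_of_forall_eval_antitone_eq_zero`,
  `Literature.NumberTheory.Automorphic.eq_of_forall_eval_antitone_eq` — Zariski density of `{λ + c}`.

## References

* J. E. Humphreys, *Introduction to Lie Algebras and Representation Theory*, GTM 9, Springer
  1972, §20.2 (maximal vectors), §23.3.
* A. W. Knapp, D. A. Vogan, *Cohomological Induction and Unitary Representations*, Princeton
  1995, §IV.7.
* A. W. Knapp, *Lie Groups Beyond an Introduction*, 2nd ed., Birkhäuser 2002, §V.5, Thm. 5.44.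
-/

-- Mathlib idiom (Mathlib/Algebra/Lie/OfAssociative.lean): the commutator bracket on matrix algebras
-- and on `Module.End`
attribute [local instance 100] LieRing.ofAssociativeRing

noncomputable section

open MvPolynomial Matrix

namespace Literature.NumberTheory.Automorphic

/-! ### Highest weight vectors for `𝔤𝔩ₙ(R)^T` -/

section HW

variable {T : Type*} [Fintype T] {n : ℕ} {R : Type*} [CommRing R]

/-- `v` is a *highest weight vector* of weight `λ : T → Fin n → R` for a representation `ρ` of the
product Lie algebra `𝔤𝔩ₙ(R)^T = (T → Matrix (Fin n) (Fin n) R)` (commutator bracket) with respect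
to the upper triangular Borel subalgebra: `v ≠ 0`, block-wise strictly upper triangular matrices
kill `v`, and the diagonal matrix `(diag (h τ))_τ` acts by `∑_τ ∑_i λ τ i · h τ i`.
Knapp–Vogan 1995, §IV.7 (before (4.88)); Humphreys 1972, §20.2 ("maximal vector"). [folklore] -/
def IsHighestWeightVectorC {V : Type*} [AddCommGroup V] [Module R V]
    (ρ : (T → Matrix (Fin n) (Fin n) R) →ₗ⁅R⁆ Module.End R V) (l : T → Fin n → R) (v : V) :
    Prop :=
  v ≠ 0 ∧ (∀ X : T → Matrix (Fin n) (Fin n) R, (∀ τ i j, j ≤ i → X τ i j = 0) → ρ X v = 0) ∧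
    ∀ h : T → Fin n → R, ρ (fun τ ↦ Matrix.diagonal (h τ)) v = (∑ τ, ∑ i, l τ i * h τ i) • v

end HW

/-! ### The block polynomial model and its highest weight vectors -/

section Model

variable (T : Type*) [Fintype T] [DecidableEq T] (n : ℕ) (R : Type*) [CommRing R]

/-- The block-diagonal embedding `𝔤𝔩ₙ(R)^T → 𝔤𝔩_{Fin n × T}(R)` as an algebra homomorphism.
[folklore] -/
def blockDiagAlgHom : (T → Matrix (Fin n) (Fin n) R) →ₐ[R] Matrix (Fin n × T) (Fin n × T) R :=
  AlgHom.mk' (Matrix.blockDiagonalRingHom (Fin n) T R) fun c X ↦ Matrix.blockDiagonal_smul c X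

/-- Unfolding the block-diagonal embedding. [folklore] -/
@[simp]
theorem blockDiagAlgHom_apply (X : T → Matrix (Fin n) (Fin n) R) :
    blockDiagAlgHom T n R X = Matrix.blockDiagonal X := rfl

/-- **The block polynomial model**: `𝔤𝔩ₙ(R)^T` acting on `R[x_pq : p, q ∈ Fin n × T]` through the
block-diagonal embedding followed by the polynomial model `glPolyRep` (infinitesimal right
translations of polynomial functions on matrices), as `R`-linear endomorphisms. [folklore] -/
def blockMinorRep : (T → Matrix (Fin n) (Fin n) R) →ₗ⁅R⁆
    Module.End R (MvPolynomial ((Fin n × T) × (Fin n × T)) R) where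
  toFun X := glPolyDerivation R (Fin n × T) (Matrix.blockDiagonal X)
  map_add' X Y := by
    rw [Matrix.blockDiagonal_add, glPolyDerivation_add, Derivation.coe_add_linearMap]
  map_smul' c X := by
    rw [Matrix.blockDiagonal_smul, glPolyDerivation_smul, Derivation.coe_smul_linearMap, RingHom.id_apply]
  map_lie' {X Y} := by
    rw [← blockDiagAlgHom_apply, ← AlgHom.toLieHom_apply, LieHom.map_lie, AlgHom.toLieHom_apply,
      AlgHom.toLieHom_apply, blockDiagAlgHom_apply, blockDiagAlgHom_apply, glPolyDerivation_lie,
      Derivation.commutator_coe_linear_map]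

variable {T n R} in
/-- Unfolding the block polynomial model. [folklore] -/
@[simp]
theorem blockMinorRep_apply (X : T → Matrix (Fin n) (Fin n) R) (f : MvPolynomial ((Fin n × T) × (Fin n × T)) R) :
    blockMinorRep T n R X f = glPolyDerivation R (Fin n × T) (Matrix.blockDiagonal X) f := rfl

variable {T n} in
/-- The nested initial segments `S (τ, k) = {(a, τ) : a ≤ k}` of block `τ`. [folklore] -/
def blockSegC (j : T × Fin n) : Finset (Fin n × T) :=
  Finset.univ.filter fun p ↦ p.2 = j.1 ∧ p.1 ≤ j.2

variable {T n} in
omit [DecidableEq T] in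
/-- Membership in a block segment. [folklore] -/
theorem mem_blockSegC [DecidableEq T] {j : T × Fin n} {p : Fin n × T} :
    p ∈ blockSegC j ↔ p.2 = j.1 ∧ p.1 ≤ j.2 := by
  simp [blockSegC]

variable {T n} in
/-- The candidate highest weight vector: `∏_{τ,k} Δ_{S(τ,k)}^{m τ k}`, a product of powers of the
block leading principal minors. [folklore] -/
def hwVec (m : T → Fin n → ℕ) : MvPolynomial ((Fin n × T) × (Fin n × T)) R :=
  hwPolyVec R (Fin n × T) blockSegC fun j : T × Fin n ↦ m j.1 j.2

variable {T n R}

/-- A block-upper-triangular tuple stabilises every block initial segment. [folklore] -/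
theorem blockDiagonal_stabilises (X : T → Matrix (Fin n) (Fin n) R)
    (hX : ∀ τ a b, b < a → X τ a b = 0) (j : T × Fin n) :
    ∀ s ∈ blockSegC j, ∀ r ∉ blockSegC j, Matrix.blockDiagonal X r s = 0 := by
  rintro ⟨a, τ⟩ hs ⟨a', τ'⟩ hr
  rw [mem_blockSegC] at hs hr
  obtain ⟨hτ, ha⟩ := hs
  by_cases hτ' : τ' = τ
  · subst hτ'
    rw [Matrix.blockDiagonal_apply_eq]
    exact hX _ _ _ (lt_of_le_of_lt ha (not_le.mp fun h ↦ hr ⟨hτ, h⟩))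
  · exact Matrix.blockDiagonal_apply_ne _ _ _ hτ'

/-- The eigenvalue of a block-upper-triangular tuple on `hwVec m`: the weighted sum of its partial
traces. [folklore] -/
theorem blockMinorRep_hwVec (X : T → Matrix (Fin n) (Fin n) R) (hX : ∀ τ a b, b < a → X τ a b = 0)
    (m : T → Fin n → ℕ) :
    blockMinorRep T n R X (hwVec R m) =
      (∑ j : T × Fin n, m j.1 j.2 • ∑ s ∈ blockSegC j, Matrix.blockDiagonal X s s) • hwVec R m :=
  glPolyDerivation_hwPolyVec _ _ _ (blockDiagonal_stabilises X hX)

omit [DecidableEq T] in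
/-- The partial trace over a block segment of a block-diagonal tuple. [folklore] -/
theorem sum_blockSegC_blockDiagonal [DecidableEq T] (X : T → Matrix (Fin n) (Fin n) R) (j : T × Fin n) :
    ∑ s ∈ blockSegC j, Matrix.blockDiagonal X s s =
      ∑ a ∈ Finset.univ.filter (fun a : Fin n ↦ a ≤ j.2), X j.1 a a := by
  rw [blockSegC, Finset.sum_filter, Finset.sum_filter, ← Finset.univ_product_univ, Finset.sum_product,
    Finset.sum_comm]
  refine (Finset.sum_eq_single j.1 (fun τ _ hτ ↦ Finset.sum_eq_zero fun a _ ↦ by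
    rw [if_neg (fun h ↦ hτ h.1)]) (by simp)).trans ?_
  refine Finset.sum_congr rfl fun a _ ↦ ?_
  simp only [true_and, Matrix.blockDiagonal_apply_eq]

omit [DecidableEq T] in
/-- Resummation: `∑_k m_k (h_0 + ⋯ + h_k) = ∑_i (∑_{k ≥ i} m_k) h_i`, i.e. the weight of
`∏_k Δ_{k+1}^{m_k}` is `Fin.accumulate n n m`. [folklore] -/
theorem sum_mul_sum_filter_le_eq (m : Fin n → ℕ) (h : Fin n → R) :
    ∑ k : Fin n, (m k : R) * ∑ a ∈ Finset.univ.filter (fun a : Fin n ↦ a ≤ k), h a =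
      ∑ i : Fin n, (Fin.accumulate n n m i : R) * h i := by
  simp_rw [Fin.accumulate_apply, Nat.cast_sum, Finset.mul_sum, Finset.sum_mul, Finset.sum_filter, Fin.le_def]
  rw [Finset.sum_comm]

/-- **The products of block leading principal minors are highest weight vectors**, of weight
`λ_{τ,i} = #{minors in block τ of size > i} = Fin.accumulate n n (m τ) i`. [folklore] -/
theorem isHighestWeightVectorC_hwVec [Nontrivial R] (m : T → Fin n → ℕ) :
    IsHighestWeightVectorC (blockMinorRep T n R) (fun τ i ↦ (Fin.accumulate n n (m τ) i : R))
      (hwVec R m) := by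
  refine ⟨hwPolyVec_ne_zero _ _, fun X hX ↦ ?_, fun h ↦ ?_⟩
  · rw [blockMinorRep_hwVec X (fun τ a b hba ↦ hX τ a b hba.le) m]
    have : (∑ j : T × Fin n, m j.1 j.2 • ∑ s ∈ blockSegC j, Matrix.blockDiagonal X s s) = 0 :=
      Finset.sum_eq_zero fun j _ ↦ by
        rw [sum_blockSegC_blockDiagonal, Finset.sum_eq_zero fun a _ ↦ hX _ _ _ le_rfl, smul_zero]
    rw [this, zero_smul]
  · rw [blockMinorRep_hwVec _ (fun τ a b hba ↦ Matrix.diagonal_apply_ne _ hba.ne') m]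
    congr 1
    simp_rw [sum_blockSegC_blockDiagonal, Matrix.diagonal_apply_eq, nsmul_eq_mul]
    rw [← Finset.univ_product_univ, Finset.sum_product]
    exact Finset.sum_congr rfl fun τ _ ↦ sum_mul_sum_filter_le_eq (m τ) (h τ)

/-! ### Reindexing the blocks, and existence in `Type` -/

/-- Reindexing the blocks along `e : T ≃ T'` is an isomorphism of Lie algebras
`𝔤𝔩ₙ^T → 𝔤𝔩ₙ^{T'}` (we only need the homomorphism). [folklore] -/
def reindexLie {T' : Type*} (e : T ≃ T') :
    (T → Matrix (Fin n) (Fin n) R) →ₗ⁅R⁆ (T' → Matrix (Fin n) (Fin n) R) where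
  toFun X := fun τ' ↦ X (e.symm τ')
  map_add' _ _ := rfl
  map_smul' _ _ := rfl
  map_lie' := rfl

omit [DecidableEq T] in
/-- Highest weight vectors are preserved under reindexing the blocks. [folklore] -/
theorem IsHighestWeightVectorC.comp_reindexLie {T' : Type*} [Fintype T']
    (e : T ≃ T') {V : Type*} [AddCommGroup V] [Module R V]
    {ρ : (T' → Matrix (Fin n) (Fin n) R) →ₗ⁅R⁆ Module.End R V} {l : T' → Fin n → R} {v : V}
    (h : IsHighestWeightVectorC ρ l v) :
    IsHighestWeightVectorC (ρ.comp (reindexLie (n := n) (R := R) e)) (fun τ ↦ l (e τ)) v := by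
  refine ⟨h.1, fun X hX ↦ h.2.1 _ fun τ' i j hij ↦ hX _ i j hij, fun hh ↦ ?_⟩
  have key := h.2.2 fun τ' ↦ hh (e.symm τ')
  have e1 : (reindexLie (n := n) (R := R) e fun τ ↦ Matrix.diagonal (hh τ)) =
      fun τ' ↦ Matrix.diagonal (hh (e.symm τ')) := rfl
  rw [LieHom.comp_apply, e1, key]
  congr 1
  exact (Fintype.sum_equiv e _ _ fun τ ↦ by simp).symm

/-- **Existence of highest weight vectors of every polynomial dominant weight** for `𝔤𝔩ₙ^T`:
for every `λ : T → Fin n → ℕ` with each `λ τ` antitone there is a representation of `𝔤𝔩ₙ(R)^T`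
on an `R`-module `V : Type` (mirroring the universe convention (H9) of `HarishChandraGL`) with a
highest weight vector of weight `λ`: `V = R[x_pq]` with the block polynomial model and
`v = ∏ Δ_{S(τ,k)}^{λ_{τ,k} - λ_{τ,k+1}}`. (Only `ℕ`-valued, "polynomial", weights are produced; these
suffice by Zariski density. Cf. Humphreys 1972, §20.2–§21.2 for the general theory of dominant
integral highest weights.) [folklore] -/
theorem exists_isHighestWeightVectorC_of_antitone {T : Type*} [Fintype T] {n : ℕ} {R : Type}
    [CommRing R] [Nontrivial R] (l : T → Fin n → ℕ) (hl : ∀ τ, Antitone (l τ)) :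
    ∃ (V : Type) (_ : AddCommGroup V) (_ : Module R V)
      (ρ : (T → Matrix (Fin n) (Fin n) R) →ₗ⁅R⁆ Module.End R V) (v : V),
      IsHighestWeightVectorC ρ (fun τ i ↦ (l τ i : R)) v := by
  set e := Fintype.equivFin T
  let m : Fin (Fintype.card T) → Fin n → ℕ := fun τ' ↦ Fin.invAccumulate n n (l (e.symm τ'))
  have hm : ∀ τ', Fin.accumulate n n (m τ') = l (e.symm τ') := fun τ' ↦
    Fin.accumulate_invAccumulate le_rfl (hl _)
  refine ⟨MvPolynomial ((Fin n × Fin (Fintype.card T)) × (Fin n × Fin (Fintype.card T))) R,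
    inferInstance, inferInstance, (blockMinorRep _ n R).comp (reindexLie e), hwVec R m, ?_⟩
  have h := (isHighestWeightVectorC_hwVec (R := R) m).comp_reindexLie e
  have hl' : (fun τ i ↦ (l τ i : R)) = fun τ i ↦ (Fin.accumulate n n (m (e τ)) i : R) := by
    funext τ i
    rw [hm, Equiv.symm_apply_apply]
  rw [hl']
  exact h

end Model

/-! ### Zariski density of the polynomial dominant weights -/

section Density

variable {K : Type*} [CommRing K] [IsDomain K] [CharZero K] {T : Type*} [Finite T] {n : ℕ}

/-- **Zariski density of polynomial dominant weights (with any shift).** A polynomial in the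
variables `x_{τ,i}` (`τ ∈ T`, `i < n`) over a domain of characteristic zero which vanishes at all
points `(λ_{τ,i} + c_{τ,i})` with `λ_{τ,·} : Fin n → ℕ` antitone for each `τ` is zero: these
points contain arbitrarily large grids. (Used with `c = ρ` to pin down the Harish-Chandra
homomorphism by its values on highest weights; cf. Knapp 2002, proof of Thm. 5.44, and
Humphreys 1972, §23.3.) [folklore] -/
theorem eq_zero_of_forall_eval_antitone_eq_zero (c : T × Fin n → K) (Q : MvPolynomial (T × Fin n) K)
    (h : ∀ l : T → Fin n → ℕ, (∀ τ, Antitone (l τ)) →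
      MvPolynomial.eval (fun p ↦ (l p.1 p.2 : K) + c p) Q = 0) :
    Q = 0 := by
  -- translate by `c`
  set Q' : MvPolynomial (T × Fin n) K := bind₁ (fun p ↦ X p + C (c p)) Q with hQ'
  have hev : ∀ x : T × Fin n → K, MvPolynomial.eval x Q' = MvPolynomial.eval (fun p ↦ x p + c p) Q := by
    intro x
    rw [hQ', MvPolynomial.eval, eval₂Hom_bind₁]
    simp
  suffices hQ'0 : Q' = 0 by
    have hQ : Q = bind₁ (fun p ↦ X p - C (c p)) Q' := by
      rw [hQ', bind₁_bind₁]
      have hg : (fun p : T × Fin n ↦ bind₁ (fun p : T × Fin n ↦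
          (X p : MvPolynomial (T × Fin n) K) - C (c p)) (X p + C (c p))) = X := by
        funext p
        simp
      rw [hg, bind₁_X_left]
      rfl
    rw [hQ, hQ'0, map_zero]
  -- the grid
  set D : ℕ := Q'.totalDegree + 1 with hD
  classical
  refine MvPolynomial.eq_zero_of_eval_zero_at_prod_finset Q'
    (fun p ↦ (Finset.range D).image fun j ↦ (((n - p.2) * D + j : ℕ) : K)) (fun p ↦ ?_) ?_
  · rw [Finset.card_image_of_injective _ fun j j' hjj' ↦ by simpa using hjj', Finset.card_range]
    exact Nat.lt_succ_of_le (degreeOf_le_totalDegree Q' p)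
  · intro x hx
    have hx' : ∀ p, ∃ j, j < D ∧ x p = (((n - p.2) * D + j : ℕ) : K) := fun p ↦ by
      obtain ⟨j, hj, hjx⟩ := Finset.mem_image.mp (hx p)
      exact ⟨j, Finset.mem_range.mp hj, hjx.symm⟩
    choose j hj hxj using hx'
    have hxl : x = fun p ↦ (((fun τ i ↦ (n - i) * D + j (τ, i)) p.1 p.2 : ℕ) : K) + 0 := by
      funext p
      rw [hxj p, add_zero]
    rw [hev, hxl]
    simp only [add_zero]
    have := h (fun τ i ↦ (n - i) * D + j (τ, i)) fun τ i i' hii' ↦ ?_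
    · simpa using this
    · rcases hii'.lt_or_eq with hlt | rfl
      · have h1 := hj (τ, i')
        have h2 : (n - (i' : ℕ)) + 1 ≤ n - (i : ℕ) := by omega
        dsimp only
        calc (n - (i' : ℕ)) * D + j (τ, i') ≤ (n - (i' : ℕ)) * D + D := by omega
          _ = (n - (i' : ℕ) + 1) * D := by ring
          _ ≤ (n - (i : ℕ)) * D := Nat.mul_le_mul_right D h2
          _ ≤ (n - (i : ℕ)) * D + j (τ, i) := Nat.le_add_right _ _
      · exact le_rfl

/-- Two polynomials agreeing at all points `λ + c`, `λ` dominant integral (antitone,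
`ℕ`-valued in each block), are equal. [folklore] -/
theorem eq_of_forall_eval_antitone_eq (c : T × Fin n → K) (P Q : MvPolynomial (T × Fin n) K)
    (h : ∀ l : T → Fin n → ℕ, (∀ τ, Antitone (l τ)) →
      MvPolynomial.eval (fun p ↦ (l p.1 p.2 : K) + c p) P =
        MvPolynomial.eval (fun p ↦ (l p.1 p.2 : K) + c p) Q) :
    P = Q := by
  rw [← sub_eq_zero]
  refine eq_zero_of_forall_eval_antitone_eq_zero c (P - Q) fun l hl ↦ ?_
  rw [map_sub, h l hl, sub_self]

end Density

end Literature.NumberTheory.Automorphic
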